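import Mathlib
import Summits.BirchSwinnertonDyer.BirchSwinnertonDyer.Theorems.ManinLocalTwoThreeAtkinLehnerSignFour
import Summits.BirchSwinnertonDyer.BirchSwinnertonDyer.Theorems.ManinLocalTwoThreeCuspThreeTorsionAtFour
import Summits.BirchSwinnertonDyer.Rank1Residual.ManinAdditive.CuspThreeTorsionAtFour
import Literature.NumberTheory.EllipticCurves.BSDHeegnerPointsTorsionProofs
import Literature.NumberTheory.EllipticCurves.ModularParametrizationDegree
import Literature.NumberTheory.EllipticCurves.HeckeOperatorsAdjointProofs
import HarnessLib

/-!
# The order-`3` automorphism `τ₃ = w(4)·t` of `Y₀(4M)`: `φ_D ∘ τ₃ = φ_D + φ_D([1/M])`, `τ₃³ = id` on `Y₀(4M)`, and the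
# `τ₃`-fixed orbits are COUNTABLE — tools for E-an-46 (`3 ∣ deg φ` at `4 ∥ N`)

Summit `BirchSwinnertonDyer`, sub-problem `BirchSwinnertonDyer`, route `ManinLocalTwoThree`; width seat `bsd-line-manin23-p2`
(gen 8), `--supports` the crux C2 `ManinOddAtFour` (stmt-BirchSwinnertonDyer-22967).  Cell `bsd-f2-manin`, analytic lens an g11
(MEMO-an §55, the `S₃`-at-`4` package), refuter-1 §R46 B.5.  Sibling file `…ThreeDvdModularDegree.lean` assembles E-an-46 from
these tools; everything here is elementary (Atkin–Lehner 1970 §4, Knapp L. 9.24, Manin 1972 Prop. 1.4).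

PROVED here (sorry-free, axioms standard), with `τ₃ := glCast w(4) * glCast t`, `t = (2 1; 0 2)`, level `4M`, `M` odd:

* `fixedPoint_quadratic`, **`scalar_of_two_fixedPoints`** — a `g ∈ GL₂⁺(ℝ)` with two fixed points in `ℍ` is scalar (Vieta:
  `c(z₁+z₂) = a − d` is real); `smul_eq_self_of_scalar` — scalars act trivially;
* `eichlerIntegral_halfTranslateGL_smul` (`E_f(t z) = −E_f(z)`, from the seat's `slash_halfTranslateGL_eq_neg`),
  **`eichlerIntegral_tau3_smul`** (`E_f(τ₃ z) = E_f(z) + {∞, x/M}_f`, from the tree's `eichlerIntegral_atkinLehnerW_smul` and the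
  seat's E-an-44 `atkinLehnerInvolution_four_eq_neg`), `modularSymbol_atkinLehnerCusp_four_sub_mem` (`{∞,x/M} ≡ {∞,1/M}`),
  **`φ_tau3_smul`** — `φ_D(τ₃ z) = φ_D(z)` for EVERY datum `D` with `φ_D([1/M]) = O`;
* `Y0_mk_smul_eq_of_mk_eq` (a normalising `g` acts on `Y₀(N)`), `tau3_mul_mul_inv_mem` (`τ₃` normalises `Γ₀(4M)`),
  **`Y0_mk_tau3_cube`** (`[τ₃³ z] = [z]`, from the seat's `(w(4)t)³ = 64γ₀`);
* `det_mapGL_val`, **`subsingleton_setOf_gamma_smul_eq_tau3_smul`** (`γ z = τ₃ z` has at most one solution: `γ⁻¹τ₃` scalar would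
  force `γ₁₀ = ±2M`, contradicting `4M ∣ γ₁₀`), **`countable_setOf_exists_gamma_smul_eq_tau3_smul`** (`Γ₀(4M)` is countable).

BSD is not proved by this; Manin's conjecture is not proved by this.
-/

set_option autoImplicit false
-- `Summit.BirchSwinnertonDyer.BirchSwinnertonDyer` is the mandated summit-side namespace (single-conjunct summit).
set_option linter.dupNamespace false

noncomputable section

open scoped MatrixGroups ModularForm
open CongruenceSubgroup Matrix.SpecialLinearGroup UpperHalfPlane
open Literature.NumberTheory.EllipticCurves Literature.NumberTheory.EllipticCurves.ModularForms
open Summit.BirchSwinnertonDyer.Rank1Residual.ManinAdditive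
open Summit.BirchSwinnertonDyer.Rank1Residual.ManinAdditive.ConwayCut

namespace Summit.BirchSwinnertonDyer.BirchSwinnertonDyer.Theorems.ManinLocalTwoThree

/-! ### Möbius transformations: two fixed points in `ℍ` force a scalar matrix -/

/-- The fixed-point equation of `g ∈ GL₂⁺(ℝ)` at `z ∈ ℍ`: `c z² + (d − a) z − b = 0`. -/
theorem fixedPoint_quadratic {g : GL (Fin 2) ℝ} (hdet : 0 < g.det.val) {z : ℍ} (h : g • z = z) :
    (g 1 0 : ℂ) * (z : ℂ) ^ 2 + ((g 1 1 : ℂ) - g 0 0) * (z : ℂ) - g 0 1 = 0 := by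
  have hden : denom g (z : ℂ) ≠ 0 := denom_ne_zero g z
  have hcoe : ((g • z : ℍ) : ℂ) = (z : ℂ) := by rw [h]
  rw [coe_smul_of_det_pos hdet, div_eq_iff hden] at hcoe
  change (g 0 0 : ℂ) * (z : ℂ) + g 0 1 = (z : ℂ) * ((g 1 0 : ℂ) * (z : ℂ) + g 1 1) at hcoe
  linear_combination -hcoe

/-- **Two distinct fixed points in `ℍ` force a scalar matrix**: if `g ∈ GL₂⁺(ℝ)` fixes `z₁ ≠ z₂` in `ℍ` then
`g = a·1` (`c = 0`, `b = 0`, `a = d`).  (Vieta: `c(z₁ + z₂) = a − d` is real, so `c·(Im z₁ + Im z₂) = 0`.) -/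
theorem scalar_of_two_fixedPoints {g : GL (Fin 2) ℝ} (hdet : 0 < g.det.val) {z₁ z₂ : ℍ} (h₁ : g • z₁ = z₁)
    (h₂ : g • z₂ = z₂) (hne : z₁ ≠ z₂) : g 1 0 = 0 ∧ g 0 1 = 0 ∧ g 0 0 = g 1 1 := by
  have e₁ := fixedPoint_quadratic hdet h₁
  have e₂ := fixedPoint_quadratic hdet h₂
  have hne' : (z₁ : ℂ) - z₂ ≠ 0 := sub_ne_zero.mpr fun h => hne (UpperHalfPlane.ext h)
  -- Vieta: `c (z₁ + z₂) + (d − a) = 0`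
  have hV : (g 1 0 : ℂ) * ((z₁ : ℂ) + z₂) + ((g 1 1 : ℂ) - g 0 0) = 0 := by
    have : ((z₁ : ℂ) - z₂) * ((g 1 0 : ℂ) * ((z₁ : ℂ) + z₂) + ((g 1 1 : ℂ) - g 0 0)) = 0 := by
      linear_combination e₁ - e₂
    exact (mul_eq_zero.mp this).resolve_left hne'
  -- imaginary part: `c (Im z₁ + Im z₂) = 0`, so `c = 0`
  have hc : g 1 0 = 0 := by
    have him := congrArg Complex.im hV
    simp only [Complex.add_im, Complex.mul_im, Complex.ofReal_re, Complex.ofReal_im, Complex.sub_im,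
      zero_mul, add_zero, Complex.zero_im, sub_self] at him
    have hpos : 0 < (z₁ : ℂ).im + (z₂ : ℂ).im := add_pos z₁.im_pos z₂.im_pos
    rcases mul_eq_zero.mp him with h | h
    · exact h
    · exact absurd h hpos.ne'
  have had : g 0 0 = g 1 1 := by
    have hre := congrArg Complex.re hV
    simp only [hc, Complex.ofReal_zero, zero_mul, zero_add, Complex.sub_re, Complex.ofReal_re,
      Complex.zero_re] at hre
    linarith
  have hb : g 0 1 = 0 := by
    rw [hc, had] at e₁
    simp only [Complex.ofReal_zero, zero_mul, zero_add, sub_self] at e₁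
    exact_mod_cast (neg_eq_zero.mp (by simpa using e₁) : (g 0 1 : ℂ) = 0)
  exact ⟨hc, hb, had⟩

/-- A scalar matrix acts trivially on `ℍ`. -/
theorem smul_eq_self_of_scalar {g : GL (Fin 2) ℝ} (hdet : 0 < g.det.val) (hc : g 1 0 = 0) (hb : g 0 1 = 0)
    (had : g 0 0 = g 1 1) (z : ℍ) : g • z = z := by
  have hd : (g 1 1 : ℝ) ≠ 0 := by
    intro h0
    have : g.det.val = g 0 0 * g 1 1 - g 0 1 * g 1 0 := by
      rw [Matrix.GeneralLinearGroup.val_det_apply, Matrix.det_fin_two]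
    rw [this, h0, hc, mul_zero, mul_zero, sub_zero] at hdet
    exact lt_irrefl _ hdet
  apply UpperHalfPlane.ext
  rw [coe_smul_of_det_pos hdet]
  change ((g 0 0 : ℂ) * (z : ℂ) + g 0 1) / ((g 1 0 : ℂ) * (z : ℂ) + g 1 1) = (z : ℂ)
  rw [hc, hb, had]
  have hd' : ((g 1 1 : ℝ) : ℂ) ≠ 0 := by exact_mod_cast hd
  rw [Complex.ofReal_zero, zero_mul, zero_add, add_zero]
  exact mul_div_cancel_left₀ _ hd'

/-! ### The order-`3` automorphism `τ₃ = w(4)·t` of `X₀(4M)` and the Eichler integral -/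

/-- **HALF-TRANSLATE on the Eichler integral**: `2πi∫_{i∞}^{t z} f = −2πi∫_{i∞}^{z} f` for a newform at `4 ∣ N`
(`f ∣ t = −f`, `t = (2 1; 0 2)`; the affine substitution along the vertical ray). -/
theorem eichlerIntegral_halfTranslateGL_smul {N : ℕ} [NeZero N] (h4 : 4 ∣ N) {f : CuspForm (Gamma0 N) 2}
    (hf : IsNewform0 f) (z : ℍ) :
    eichlerIntegral f (glCast (halfTranslateGL : GL (Fin 2) ℚ) • z) = -eichlerIntegral f z := by
  have hg10 : (glCast (halfTranslateGL : GL (Fin 2) ℚ) : GL (Fin 2) ℝ) 1 0 = 0 := by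
    show ((glCast (halfTranslateGL : GL (Fin 2) ℚ) : GL (Fin 2) ℝ) : Matrix (Fin 2) (Fin 2) ℝ) 1 0 = 0
    rw [val_glCast_halfTranslateGL]
    simp
  have hV := verticalIntegral_slash_of_apply_one_zero_eq_zero (⇑f) hg10 (det_glCast_pos halfTranslateGL) z
  rw [slash_halfTranslateGL_eq_neg h4 f hf, show (-⇑f : ℍ → ℂ) = (-1 : ℂ) • ⇑f by ext; simp,
    verticalIntegral_const_smul] at hV
  change verticalIntegral (⇑f) _ = -verticalIntegral (⇑f) z
  rw [← hV, neg_one_mul]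

/-- **The Eichler integral is `τ₃`-invariant up to the cusp symbol `{∞, x/M}`** (`τ₃ = w(4)·t`, `x = w(4)₀₀/4`):
`2πi∫_{i∞}^{τ₃ z} f = 2πi∫_{i∞}^{z} f + {∞, x/M}_f` for every newform `f` on `Γ₀(4M)`, `M` odd
(`w₄ f = −f` by E-an-44 and `f ∣ t = −f`). -/
theorem eichlerIntegral_tau3_smul {M : ℕ} [NeZero (4 * M)] (hM : Odd M) {f : CuspForm (Gamma0 (4 * M)) 2}
    (hf : IsNewform0 f) (z : ℍ) :
    eichlerIntegral f ((glCast (atkinLehnerW (4 * M) 4 : GL (Fin 2) ℚ) * glCast (halfTranslateGL : GL (Fin 2) ℚ)) • z) =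
      eichlerIntegral f z + modularSymbol f ((atkinLehnerSL (4 * M) 4 0 0 : ℚ) / (4 * M / 4 : ℕ)) := by
  have h4 : 4 ∣ 4 * M := dvd_mul_right 4 M
  have hdiv : 4 * M / 4 = M := Nat.mul_div_cancel_left M (by norm_num)
  have hcop : Nat.Coprime 4 (4 * M / 4) := by
    rw [hdiv]
    obtain ⟨m', hm'⟩ := hM
    have h2 : Nat.Coprime 2 M := Nat.prime_two.coprime_iff_not_dvd.mpr (by omega)
    simpa using h2.pow_left 2
  have hε : atkinLehnerInvolution (4 * M) 2 4 f = (-1 : ℂ) • f := by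
    rw [atkinLehnerInvolution_four_eq_neg hM f hf, neg_one_smul]
  rw [mul_smul, eichlerIntegral_atkinLehnerW_smul h4 hcop hε, eichlerIntegral_halfTranslateGL_smul h4 hf]
  ring

/-- The cusp `x/M = w(4)∞` is `Γ₀(4M)`-equivalent to `1/M`: `{∞, x/M}_f − {∞, 1/M}_f ∈ Λ_f` (the matrix `γ₁` of the seat's
hexagon file). -/
theorem modularSymbol_atkinLehnerCusp_four_sub_mem {M : ℕ} [NeZero (4 * M)] (hM : Odd M)
    (f : CuspForm (Gamma0 (4 * M)) 2) :
    modularSymbol f ((atkinLehnerSL (4 * M) 4 0 0 : ℚ) / (4 * M / 4 : ℕ)) - modularSymbol f (1 / (M : ℚ)) ∈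
      periodLattice f := by
  obtain ⟨m', hm'⟩ := hM
  have hMne : (M : ℤ) ≠ 0 := by omega
  have hdiv : 4 * M / 4 = M := Nat.mul_div_cancel_left M (by norm_num)
  have hcop : Nat.Coprime 4 (4 * M / 4) := by
    rw [hdiv]
    have h2 : Nat.Coprime 2 M := Nat.prime_two.coprime_iff_not_dvd.mpr (by omega)
    simpa using h2.pow_left 2
  have hN : ((4 * M : ℕ) : ℤ) = 4 * (M : ℤ) := by push_cast; ring
  set x : ℤ := atkinLehnerSL (4 * M) 4 0 0 with hx
  set y : ℤ := atkinLehnerSL (4 * M) 4 0 1 with hy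
  have hbez : 4 * x - (M : ℤ) * y = 1 := by
    have h := atkinLehnerSL_bezout (4 * M) 4 hcop
    rw [hdiv] at h
    exact_mod_cast h
  have qM : (1 / (M : ℚ)) = ((1 : ℤ) : ℚ) / ((M : ℤ) : ℚ) := by push_cast; ring
  have qxM : ((x : ℚ) / (4 * M / 4 : ℕ)) = ((x : ℤ) : ℚ) / ((M : ℤ) : ℚ) := by rw [hdiv]; push_cast; ring
  rw [qM, qxM]
  exact modularSymbol_div_sub_div_mem_periodLattice f (a := x - M * y * (1 + 3 * x)) (b := y * (1 + 3 * x))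
    (c := -12 * M * x) (d := 1 + 12 * x) (by linear_combination (1 + 3 * x) * hbez)
    ⟨-3 * x, by rw [hN]; ring⟩ 1 M x M hMne hMne (by ring_nf; exact hMne) (by ring)

/-- **`φ_D ∘ τ₃ = φ_D + φ_D([1/M])`**, hence **`φ_D ∘ τ₃ = φ_D` when the cusp `1/M` maps to `O`** (the row's hypothesis):
the modular parametrisation of ANY datum at level `4M`, `M` odd, is invariant under the order-`3` automorphism
`τ₃ = w(4)·t` of `X₀(4M)` as soon as `φ_D([1/M]) = O`. -/
theorem φ_tau3_smul {M : ℕ} [NeZero (4 * M)] (hM : Odd M) {W : WeierstrassCurve ℚ} [W.IsElliptic]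
    (D : ModularParametrizationData W (4 * M))
    (h0 : D.uniformize ((D.c : ℂ) * modularSymbol D.f (1 / (M : ℚ))) = 0) (z : ℍ) :
    D.φ ((glCast (atkinLehnerW (4 * M) 4 : GL (Fin 2) ℚ) * glCast (halfTranslateGL : GL (Fin 2) ℚ)) • z) = D.φ z := by
  have hE := eichlerIntegral_tau3_smul hM D.isNewformOf.1 z
  have l1 := modularSymbol_atkinLehnerCusp_four_sub_mem hM D.f
  set u := modularSymbol D.f ((atkinLehnerSL (4 * M) 4 0 0 : ℚ) / (4 * M / 4 : ℕ)) with hu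
  set sM := modularSymbol D.f (1 / (M : ℚ)) with hsM
  simp only [ModularParametrizationData.φ]
  rw [hE, mul_add, map_add, show (D.c : ℂ) * u = D.c * sM + D.c * (u - sM) by ring, map_add, h0, zero_add,
    (D.uniformize_eq_zero_iff _).mpr (D.smul_periodLattice_le _ l1), add_zero]

/-! ### `τ₃` normalises `Γ₀(4M)`: the induced permutation of `Y₀(4M)` and of the fibres of `φ_D` -/

/-- An element `g ∈ GL₂⁺(ℝ)` normalising `Γ₀(N)` respects `Γ₀(N)`-equivalence on `ℍ`:
`[a] = [b] ⟹ [g a] = [g b]` in `Y₀(N)`. -/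
theorem Y0_mk_smul_eq_of_mk_eq {N : ℕ} {g : GL (Fin 2) ℝ}
    (hg : ∀ x ∈ (Gamma0 N : Subgroup (GL (Fin 2) ℝ)), g * x * g⁻¹ ∈ (Gamma0 N : Subgroup (GL (Fin 2) ℝ)))
    {a b : ℍ} (h : Y0.mk N a = Y0.mk N b) : Y0.mk N (g • a) = Y0.mk N (g • b) := by
  obtain ⟨γ, rfl⟩ := (Y0.mk_eq_mk_iff N a b).mp h
  rw [Y0.mk_eq_mk_iff]
  obtain ⟨γ', hγ', hγ'eq⟩ := Subgroup.mem_map.mp (hg _ (Subgroup.mem_map_of_mem (mapGL ℝ) γ.2))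
  refine ⟨⟨γ', hγ'⟩, ?_⟩
  change (mapGL ℝ γ' : GL (Fin 2) ℝ) • (g • b) = g • ((mapGL ℝ (γ : SL(2, ℤ)) : GL (Fin 2) ℝ) • b)
  rw [hγ'eq, mul_smul, mul_smul, inv_smul_smul]

/-- **`τ₃ = w(4)·t` normalises `Γ₀(4M)`** (`w(4)` and `t` both do: Knapp L. 9.24, Atkin–Lehner L. 27). -/
theorem tau3_mul_mul_inv_mem {M : ℕ} [NeZero (4 * M)] (hM : Odd M) {x : GL (Fin 2) ℝ}
    (hx : x ∈ (Gamma0 (4 * M) : Subgroup (GL (Fin 2) ℝ))) :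
    glCast (atkinLehnerW (4 * M) 4 : GL (Fin 2) ℚ) * glCast (halfTranslateGL : GL (Fin 2) ℚ) * x *
        (glCast (atkinLehnerW (4 * M) 4 : GL (Fin 2) ℚ) * glCast (halfTranslateGL : GL (Fin 2) ℚ))⁻¹ ∈
      (Gamma0 (4 * M) : Subgroup (GL (Fin 2) ℝ)) := by
  have h4 : 4 ∣ 4 * M := dvd_mul_right 4 M
  have hdiv : 4 * M / 4 = M := Nat.mul_div_cancel_left M (by norm_num)
  have hcop : Nat.Coprime 4 (4 * M / 4) := by
    rw [hdiv]
    obtain ⟨m', hm'⟩ := hM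
    have h2 : Nat.Coprime 2 M := Nat.prime_two.coprime_iff_not_dvd.mpr (by omega)
    simpa using h2.pow_left 2
  have h := atkinLehnerW_mul_mul_inv_mem (4 * M) 4 h4 hcop (halfTranslateGL_mul_mul_inv_mem h4 hx)
  rw [mul_inv_rev, show glCast (atkinLehnerW (4 * M) 4 : GL (Fin 2) ℚ) * glCast (halfTranslateGL : GL (Fin 2) ℚ) * x *
      ((glCast (halfTranslateGL : GL (Fin 2) ℚ))⁻¹ * (glCast (atkinLehnerW (4 * M) 4 : GL (Fin 2) ℚ))⁻¹) =
    glCast (atkinLehnerW (4 * M) 4 : GL (Fin 2) ℚ) *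
      (glCast (halfTranslateGL : GL (Fin 2) ℚ) * x * (glCast (halfTranslateGL : GL (Fin 2) ℚ))⁻¹) *
      (glCast (atkinLehnerW (4 * M) 4 : GL (Fin 2) ℚ))⁻¹ by simp only [mul_assoc]]
  exact h

/-- **`τ₃³` acts on `Y₀(4M)` as the identity**: `[τ₃ τ₃ τ₃ z] = [z]` (`(w(4)t)³ = 64·γ₀`, `γ₀ ∈ Γ₀(4M)`; the scalar `64`
acts trivially on `ℍ`). -/
theorem Y0_mk_tau3_cube {M : ℕ} [NeZero (4 * M)] (hM : Odd M) (z : ℍ) :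
    Y0.mk (4 * M) ((glCast (atkinLehnerW (4 * M) 4 : GL (Fin 2) ℚ) * glCast (halfTranslateGL : GL (Fin 2) ℚ)) •
      (glCast (atkinLehnerW (4 * M) 4 : GL (Fin 2) ℚ) * glCast (halfTranslateGL : GL (Fin 2) ℚ)) •
      (glCast (atkinLehnerW (4 * M) 4 : GL (Fin 2) ℚ) * glCast (halfTranslateGL : GL (Fin 2) ℚ)) • z) =
      Y0.mk (4 * M) z := by
  have hdiv : 4 * M / 4 = M := Nat.mul_div_cancel_left M (by norm_num)
  have hcop : Nat.Coprime 4 (4 * M / 4) := by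
    rw [hdiv]
    obtain ⟨m', hm'⟩ := hM
    have h2 : Nat.Coprime 2 M := Nat.prime_two.coprime_iff_not_dvd.mpr (by omega)
    simpa using h2.pow_left 2
  obtain ⟨γ₀, hγ₀, hcube⟩ := atkinLehnerW_mul_halfTranslateGL_cube hM hcop
  rw [smul_smul, smul_smul, hcube, mul_smul, Y0.mk_eq_mk_iff]
  refine ⟨⟨γ₀, hγ₀⟩, ?_⟩
  change (mapGL ℝ γ₀ : GL (Fin 2) ℝ) • z = (tpD 64 * tpG 64) • (mapGL ℝ γ₀ : GL (Fin 2) ℝ) • z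
  have hdet : 0 < (tpD 64 * tpG 64 : GL (Fin 2) ℝ).det.val := by
    rw [map_mul, Units.val_mul]
    have h1 : 0 < (tpD 64 : GL (Fin 2) ℝ).det.val := by
      rw [Matrix.GeneralLinearGroup.val_det_apply, val_tpD, Matrix.det_fin_two_of]; norm_num
    have h2 : 0 < (tpG 64 : GL (Fin 2) ℝ).det.val := by
      rw [Matrix.GeneralLinearGroup.val_det_apply, val_tpG, Matrix.det_fin_two_of]; norm_num
    exact mul_pos h1 h2
  have hval : ((tpD 64 * tpG 64 : GL (Fin 2) ℝ) : Matrix (Fin 2) (Fin 2) ℝ) = !![(64 : ℝ), 0; 0, 64] := by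
    rw [Matrix.GeneralLinearGroup.coe_mul, val_tpD, val_tpG]
    ext i j
    fin_cases i <;> fin_cases j <;> simp [Matrix.mul_apply, Fin.sum_univ_two]
  have e10 : (tpD 64 * tpG 64 : GL (Fin 2) ℝ) 1 0 = 0 := by
    show ((tpD 64 * tpG 64 : GL (Fin 2) ℝ) : Matrix (Fin 2) (Fin 2) ℝ) 1 0 = 0; rw [hval]; simp
  have e01 : (tpD 64 * tpG 64 : GL (Fin 2) ℝ) 0 1 = 0 := by
    show ((tpD 64 * tpG 64 : GL (Fin 2) ℝ) : Matrix (Fin 2) (Fin 2) ℝ) 0 1 = 0; rw [hval]; simp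
  have e00 : (tpD 64 * tpG 64 : GL (Fin 2) ℝ) 0 0 = (tpD 64 * tpG 64 : GL (Fin 2) ℝ) 1 1 := by
    show ((tpD 64 * tpG 64 : GL (Fin 2) ℝ) : Matrix (Fin 2) (Fin 2) ℝ) 0 0 =
      ((tpD 64 * tpG 64 : GL (Fin 2) ℝ) : Matrix (Fin 2) (Fin 2) ℝ) 1 1
    rw [hval]; simp
  rw [smul_eq_self_of_scalar hdet e10 e01 e00]

/-! ### The fixed points of `τ₃` on `Y₀(4M)` are COUNTABLE (no Fuchsian finiteness needed) -/

/-- The determinant of the image of `γ ∈ SL(2, ℤ)` in `GL(2, ℝ)` is `1`. -/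
theorem det_mapGL_val (γ : SL(2, ℤ)) : (mapGL ℝ γ : GL (Fin 2) ℝ).det.val = 1 := by
  have hdet := Matrix.SpecialLinearGroup.det_coe γ
  rw [Matrix.det_fin_two] at hdet
  rw [Matrix.GeneralLinearGroup.val_det_apply, val_mapGL', Matrix.det_fin_two]
  simp only [Matrix.map_apply]
  exact_mod_cast hdet

/-- **For `γ ∈ Γ₀(4M)` the equation `γ z = τ₃ z` has at most ONE solution `z ∈ ℍ`**: two solutions would make
`γ⁻¹τ₃` scalar, i.e. `τ₃ = a·γ` with `a² = det τ₃ = 16`, whence `γ₁₀ = ±2M`, contradicting `4M ∣ γ₁₀`. -/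
theorem subsingleton_setOf_gamma_smul_eq_tau3_smul {M : ℕ} [NeZero (4 * M)] (hM : Odd M) (γ : Gamma0 (4 * M)) :
    ({z : ℍ | γ • z = (glCast (atkinLehnerW (4 * M) 4 : GL (Fin 2) ℚ) * glCast (halfTranslateGL : GL (Fin 2) ℚ)) • z}
      : Set ℍ).Subsingleton := by
  have h4 : 4 ∣ 4 * M := dvd_mul_right 4 M
  have hdiv : 4 * M / 4 = M := Nat.mul_div_cancel_left M (by norm_num)
  have hcop : Nat.Coprime 4 (4 * M / 4) := by
    rw [hdiv]
    obtain ⟨m', hm'⟩ := hM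
    have h2 : Nat.Coprime 2 M := Nat.prime_two.coprime_iff_not_dvd.mpr (by omega)
    simpa using h2.pow_left 2
  set τ₃ : GL (Fin 2) ℝ := glCast (atkinLehnerW (4 * M) 4 : GL (Fin 2) ℚ) * glCast (halfTranslateGL : GL (Fin 2) ℚ)
    with hτ₃
  set G : GL (Fin 2) ℝ := (mapGL ℝ (γ : SL(2, ℤ)) : GL (Fin 2) ℝ) with hG
  set g : GL (Fin 2) ℝ := G⁻¹ * τ₃ with hg
  -- determinants
  have hdetτ : 0 < τ₃.det.val := by
    rw [hτ₃, map_mul, Units.val_mul]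
    exact mul_pos (det_glCast_pos _) (det_glCast_pos _)
  have hdetG : G.det.val = 1 := det_mapGL_val γ
  have hdetg : 0 < g.det.val := by
    rw [hg, map_mul, map_inv, Units.val_mul, Units.val_inv_eq_inv_val, hdetG, inv_one, one_mul]
    exact hdetτ
  -- the set is the fixed-point set of `g`
  have hset : ∀ z : ℍ, γ • z = τ₃ • z ↔ g • z = z := by
    intro z
    change G • z = τ₃ • z ↔ (G⁻¹ * τ₃) • z = z
    rw [mul_smul G⁻¹ τ₃ z, inv_smul_eq_iff, eq_comm]
  intro z₁ h₁ z₂ h₂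
  by_contra hne
  rw [Set.mem_setOf_eq, hset] at h₁ h₂
  obtain ⟨hc, hb, had⟩ := scalar_of_two_fixedPoints hdetg h₁ h₂ hne
  -- `τ₃ = G * g` with `g` scalar: compare the `(1,0)` entries and determinants
  have hGg : G * g = τ₃ := by rw [hg, mul_inv_cancel_left]
  have hent : ∀ i j, (τ₃ : Matrix (Fin 2) (Fin 2) ℝ) i j =
      ∑ k, (G : Matrix (Fin 2) (Fin 2) ℝ) i k * (g : Matrix (Fin 2) (Fin 2) ℝ) k j := by
    intro i j
    rw [← hGg, Matrix.GeneralLinearGroup.coe_mul, Matrix.mul_apply]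
  have h10 := hent 1 0
  rw [Fin.sum_univ_two] at h10
  have hτ10 : (τ₃ : Matrix (Fin 2) (Fin 2) ℝ) 1 0 = 8 * M := by
    rw [hτ₃, Matrix.GeneralLinearGroup.coe_mul, val_glCast_atkinLehnerW (4 * M) 4 h4 hcop, val_glCast_halfTranslateGL]
    simp [Matrix.mul_apply, Fin.sum_univ_two]
    ring
  have hG10 : (G : Matrix (Fin 2) (Fin 2) ℝ) 1 0 = (((γ : SL(2, ℤ)) 1 0 : ℤ) : ℝ) := by
    rw [hG, val_mapGL']
    simp
  have hG11g : (G : Matrix (Fin 2) (Fin 2) ℝ) 1 1 * (g : Matrix (Fin 2) (Fin 2) ℝ) 1 0 = 0 := by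
    rw [show (g : Matrix (Fin 2) (Fin 2) ℝ) 1 0 = g 1 0 from rfl, hc, mul_zero]
  rw [hτ10, hG10, hG11g, add_zero] at h10
  -- determinant: `det τ₃ = det G · det g = a²` and `det τ₃ = 16`
  have hdet16 : τ₃.det.val = 16 := by
    have hbez := atkinLehnerSL_bezout (4 * M) 4 hcop
    rw [hdiv] at hbez
    have hbezR : (4 : ℝ) * ((atkinLehnerSL (4 * M) 4) 0 0 : ℝ) - (M : ℝ) * ((atkinLehnerSL (4 * M) 4) 0 1 : ℝ) = 1 := by
      exact_mod_cast hbez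
    rw [hτ₃, Matrix.GeneralLinearGroup.val_det_apply, Matrix.GeneralLinearGroup.coe_mul, Matrix.det_mul,
      val_glCast_atkinLehnerW (4 * M) 4 h4 hcop, val_glCast_halfTranslateGL, Matrix.det_fin_two_of,
      Matrix.det_fin_two_of]
    push_cast
    linear_combination (16 : ℝ) * hbezR
  have hdetprod : τ₃.det.val = G.det.val * g.det.val := by rw [← hGg, map_mul, Units.val_mul]
  have hdetg' : g.det.val = g 0 0 * g 0 0 := by
    rw [Matrix.GeneralLinearGroup.val_det_apply, Matrix.det_fin_two]
    rw [show (g : Matrix (Fin 2) (Fin 2) ℝ) 1 0 = g 1 0 from rfl, show (g : Matrix (Fin 2) (Fin 2) ℝ) 0 1 = g 0 1 from rfl,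
      show (g : Matrix (Fin 2) (Fin 2) ℝ) 1 1 = g 1 1 from rfl, show (g : Matrix (Fin 2) (Fin 2) ℝ) 0 0 = g 0 0 from rfl,
      hc, hb, ← had]
    ring
  rw [hdetprod, hdetG, one_mul, hdetg'] at hdet16
  -- so `(γ₁₀ · a)² = 64 M²` with `a² = 16`: `γ₁₀² = 4M²`
  set a : ℝ := g 0 0 with ha
  set c : ℤ := (γ : SL(2, ℤ)) 1 0 with hcdef
  have hsq : ((c : ℝ)) ^ 2 * 16 = 64 * (M : ℝ) ^ 2 := by
    have : ((c : ℝ) * a) ^ 2 = (8 * (M : ℝ)) ^ 2 := by rw [← h10]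
    nlinarith [this, hdet16]
  have hsqZ : c ^ 2 = 4 * (M : ℤ) ^ 2 := by
    have : ((c : ℝ)) ^ 2 = 4 * (M : ℝ) ^ 2 := by linarith
    exact_mod_cast this
  -- `4M ∣ c` (Γ₀ condition)
  have hdvd : ((4 * M : ℕ) : ℤ) ∣ c := by
    have hmem := γ.2
    rw [Gamma0_mem] at hmem
    exact (ZMod.intCast_zmod_eq_zero_iff_dvd c (4 * M)).mp hmem
  obtain ⟨k, hk⟩ := hdvd
  have hMpos : (0 : ℤ) < M := by
    have hM0 : M ≠ 0 := fun h => NeZero.ne (4 * M) (by rw [h, mul_zero])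
    exact_mod_cast Nat.pos_of_ne_zero hM0
  rw [hk] at hsqZ
  push_cast at hsqZ
  -- `(4Mk)² = 4M²` ⇒ `4k² = 1`, impossible in `ℤ`
  have h4k : 4 * k ^ 2 = 1 := by
    have hM2 : (M : ℤ) ^ 2 ≠ 0 := pow_ne_zero 2 hMpos.ne'
    have : (M : ℤ) ^ 2 * (16 * k ^ 2) = (M : ℤ) ^ 2 * 4 := by linear_combination hsqZ
    have := mul_left_cancel₀ hM2 this
    linarith
  have : (4 : ℤ) ∣ 1 := ⟨k ^ 2, by linarith⟩
  omega

/-- **The set of `z ∈ ℍ` whose `Γ₀(4M)`-orbit is fixed by `τ₃` is COUNTABLE** (a countable union, over `γ ∈ Γ₀(4M)`, of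
subsingletons). -/
theorem countable_setOf_exists_gamma_smul_eq_tau3_smul {M : ℕ} [NeZero (4 * M)] (hM : Odd M) :
    ({z : ℍ | ∃ γ : Gamma0 (4 * M),
        γ • z = (glCast (atkinLehnerW (4 * M) 4 : GL (Fin 2) ℚ) * glCast (halfTranslateGL : GL (Fin 2) ℚ)) • z}
      : Set ℍ).Countable := by
  haveI : Countable SL(2, ℤ) := countable_SL2Z
  have hunion : ({z : ℍ | ∃ γ : Gamma0 (4 * M),
      γ • z = (glCast (atkinLehnerW (4 * M) 4 : GL (Fin 2) ℚ) * glCast (halfTranslateGL : GL (Fin 2) ℚ)) • z}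
        : Set ℍ) = ⋃ γ : Gamma0 (4 * M),
      {z : ℍ | γ • z = (glCast (atkinLehnerW (4 * M) 4 : GL (Fin 2) ℚ) * glCast (halfTranslateGL : GL (Fin 2) ℚ)) • z} := by
    ext z
    simp only [Set.mem_setOf_eq, Set.mem_iUnion]
  rw [hunion]
  exact Set.countable_iUnion fun γ => (subsingleton_setOf_gamma_smul_eq_tau3_smul hM γ).countable

end Summit.BirchSwinnertonDyer.BirchSwinnertonDyer.Theorems.ManinLocalTwoThree

end
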